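import Literature.AlgebraicGeometry.Deformation.MorphismLiftsSquareZeroCechCocycle
import HarnessLib

/-!
# A global lift kills the Čech cocycles of every family of local lifts
# ([SGA1] III Prop. 5.1: «si un prolongement global existe, la classe est nulle»; [MFK94] Prop. 6.15, functoriality step)

Layer `Literature/AlgebraicGeometry/Deformation` (cell hodgecm-mathlib, (E) of [MFK94] Prop. 6.15, brick C4 §3 (T3) of
`B-provers/B-p01/g16/SOCKETS-A4b-FileA-E.v0`).  THEOREMS ONLY.  Over ★ `MorphismLiftsSquareZeroCechCocycle`.

In the SETTING of ★ `exists_cechCocycle` (flat `A`-scheme `Z` with thickening `i` and closed fibre `pr`, affine opens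
`U_α` with affine double∕triple intersections, target `X` with reduction `X₀` carrying a coframe, local `S`-lifts `g_α` of
`f₀` through affine `V_α`), suppose a GLOBAL `S`-lift `G : Z → X` of `f₀` exists.  Then its restrictions
`G_α = fromSpec_{U_α} ≫ G` are local lifts too, and for ANY cochains `c ρ t` carrying the characteristic identities of the
family `(g_α)` (★ `exists_cechCocycle`): `c ρ t = d⁰ b ρ t` with `(b ρ t)_α` the matrix of the pair `(G_α, g_α)` — because
on `U_α ∩ U_β` the matrices add up (★ `matrix_add`), the pair `(G_α, G_β)` has equal charts (★ `matrix_eq_zero_of_eq`),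
and matrices restrict (★ `matrix_restrict`).  So every `c ρ t` is a Čech COBOUNDARY (`cechCocycle_mem_cechB1_of_lift`).

HC_CM is proved only modulo the 7 printed citations until rung 0 closes; this file discharges none of them.

## References
* [SGA1] A. Grothendieck, M. Raynaud, *SGA 1*, LNM 224 / arXiv:math/0206203: Exp. III §5 Prop. 5.1 (arXiv ed. p. 71).
* [MumfordFogartyKirwan1994] D. Mumford, J. Fogarty, F. Kirwan, *Geometric Invariant Theory*, 3rd ed. (1994), Ch. 6 §3
  Prop. 6.15 (pp. 124–125).
-/

noncomputable section

universe u

open CategoryTheory CategoryTheory.Limits AlgebraicGeometry Opposite IsLocalRing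

namespace Literature.AlgebraicGeometry.Deformation

open Literature.AlgebraicGeometry.Modules Literature.AlgebraicGeometry.Motives Literature.AlgebraicGeometry.HodgeTheory
  Literature.AlgebraicGeometry.Morphisms

section Lift

variable {A : Type u} [CommRing A] [IsLocalRing A] (J : Ideal A) {r : ℕ} (j : Fin r → A)
  {X : Scheme.{u}} (p : X ⟶ Spec (.of A)) {X₀ : Over (Spec (.of (A ⧸ J)))} {G : X₀.left ⟶ X}
  (hG : IsPullback G X₀.hom p (Spec.map (CommRingCat.ofHom (Ideal.Quotient.mk J))))
  {I : Type u} [Fintype I] (e : SheafOfModules.free I ≅ (cotangentSheaf X₀).over ⊤)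
  {Z Z₀ Zb : Scheme.{u}} (q : Z ⟶ Spec (.of A)) {q₀ : Z₀ ⟶ Spec (.of (A ⧸ J))} {i : Z₀ ⟶ Z}
  (hi : IsPullback i q₀ q (Spec.map (CommRingCat.ofHom (Ideal.Quotient.mk J))))
  {qb : Zb ⟶ Spec (.of (ResidueField A))} {pr : Zb ⟶ Z}
  (hpr : IsPullback pr qb q (Spec.map (CommRingCat.ofHom (residue A)))) (fZb : Zb ⟶ Spec (.of A))
  (f₀ : Z₀ ⟶ X) {ι : Type*} (U : ι → Z.Opens) (V : ι → X.Opens) (Ub : ι → Zb.Opens)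
  (hU : ∀ α, IsAffineOpen (U α)) (hU₂ : ∀ α β, IsAffineOpen (U α ⊓ U β))
  (hV : ∀ α, IsAffineOpen (V α)) (hV₂ : ∀ α β, IsAffineOpen (V α ⊓ V β))
  (hUb : ∀ α, Ub α = pr ⁻¹ᵁ U α)
  (g : ∀ α, Spec (.of Γ(Z, U α)) ⟶ X) (w : ∀ α, g α ≫ p = (hU α).fromSpec ≫ q) (hg : ∀ α, (g α) ⁻¹ᵁ V α = ⊤)
  (h₀ : ∀ α, Spec.map (i.app (U α)) ≫ g α = (isAffineOpen_preimage_of_isPullback_mk J hi ⟨U α, hU α⟩).fromSpec ≫ f₀)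

omit [IsLocalRing A] in
include hi in
/-- **The restrictions of a global lift are local lifts**: for `G_Z : Z → X` over `S` with `i ≫ G_Z = f₀`, the composite
`fromSpec_{U} ≫ G_Z : Spec Γ(Z, U) → X` is over `S`, reduces to `fromSpec_{i⁻¹U} ≫ f₀`, and lands in every open `V`
in which some local lift of `f₀` on `U` lands (`J² = 0`: same underlying map). [cite: SGA1, Exp. III §5 Prop. 5.1] -/
theorem fromSpec_comp_isLift (hJ2 : J * J = ⊥) {U' : Z.Opens} (hU' : IsAffineOpen U') (Gl : Z ⟶ X) (wG : Gl ≫ p = q)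
    (hG₀ : i ≫ Gl = f₀) :
    (hU'.fromSpec ≫ Gl) ≫ p = hU'.fromSpec ≫ q ∧
      Spec.map (i.app U') ≫ (hU'.fromSpec ≫ Gl) =
        (isAffineOpen_preimage_of_isPullback_mk J hi ⟨U', hU'⟩).fromSpec ≫ f₀ ∧
      ∀ {V' : X.Opens} (t : Spec (.of Γ(Z, U')) ⟶ X),
        Spec.map (i.app U') ≫ t = (isAffineOpen_preimage_of_isPullback_mk J hi ⟨U', hU'⟩).fromSpec ≫ f₀ →
        t ⁻¹ᵁ V' = ⊤ → (hU'.fromSpec ≫ Gl) ⁻¹ᵁ V' = ⊤ := by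
  have hred : Spec.map (i.app U') ≫ (hU'.fromSpec ≫ Gl) =
      (isAffineOpen_preimage_of_isPullback_mk J hi ⟨U', hU'⟩).fromSpec ≫ f₀ := by
    rw [← Category.assoc, Scheme.Hom.app_eq_appLE,
      IsAffineOpen.SpecMap_appLE_fromSpec i hU' (isAffineOpen_preimage_of_isPullback_mk J hi ⟨U', hU'⟩) le_rfl,
      Category.assoc, hG₀]
  refine ⟨by rw [Category.assoc, wG], hred, fun t ht htV => ?_⟩
  haveI := surjective_specMap_app_of_isPullback_mk J hi hJ2 ⟨U', hU'⟩
  rw [preimage_eq_of_comp_eq _ (hred.trans ht.symm)]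
  exact htV


include hG hi hpr hU hU₂ hV hV₂ hUb w hg h₀ in
/-- **A GLOBAL LIFT KILLS THE COCYCLES** ([SGA1] III Prop. 5.1: if a global extension exists the obstruction class
vanishes; [MFK94] Prop. 6.15: «`β_i = 0` since `μ₀ ∘ g_i` extends»).  In the setting of ★ `exists_cechCocycle`, let
`c ρ t ∈ Č¹(Ū, 𝒪_{Z̄})` be cochains carrying the characteristic identities of the family of local lifts `(g_α)` (for
instance the cocycles of ★ `exists_cechCocycle`), and let `G_Z : Z → X` be a global `S`-lift of `f₀`.  Then every
`c ρ t` is a coboundary: `c ρ t = d⁰ b` where `(b ρ t)_α` is the matrix of the pair `(fromSpec_{U_α} ≫ G_Z, g_α)`.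
[cite: SGA1, Exp. III §5 Prop. 5.1] [cite: MumfordFogartyKirwan1994, Ch. 6 §3 Prop. 6.15 (pp. 124–125)] -/
theorem cechCochain_mem_cechB1_of_lift [Flat q] (hj : ∀ ρ, j ρ ∈ J) (hspan : J ≤ Ideal.span (Set.range j))
    (hind : ∀ a : Fin r → A, ∑ ρ, a ρ * j ρ = 0 → ∀ ρ, a ρ ∈ maximalIdeal A)
    (hmJ : maximalIdeal A * J = ⊥) (hJle : J ≤ maximalIdeal A)
    (c : Fin r → I → CechC1 fZb Ub)
    (hc : ∀ (α β : ι)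
        (h₁' : (Spec.map (Z.presheaf.map (homOfLE (inf_le_left : U α ⊓ U β ≤ U α)).op) ≫ g α) ⁻¹ᵁ (V α ⊓ V β) = ⊤)
        (h₂' : (Spec.map (Z.presheaf.map (homOfLE (inf_le_right : U α ⊓ U β ≤ U β)).op) ≫ g β) ⁻¹ᵁ (V α ⊓ V β) = ⊤)
        (ψ₀ : Γ(X₀.left, G ⁻¹ᵁ (V α ⊓ V β)) →+* Γ(Zb, Ub α ⊓ Ub β)),
        (∀ a, ψ₀ (G.app (V α ⊓ V β) a) =
          pr.appLE (U α ⊓ U β) (Ub α ⊓ Ub β) (inf_eq_preimage_inf U Ub hUb α β).le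
            (((Spec.map (Z.presheaf.map (homOfLE (inf_le_left : U α ⊓ U β ≤ U α)).op) ≫ g α).appLE (V α ⊓ V β) ⊤
              h₁'.ge ≫ (Scheme.ΓSpecIso (.of Γ(Z, U α ⊓ U β))).hom) a)) →
        ∀ (a : Γ(X, V α ⊓ V β)) (d : Fin r → Γ(Z, U α ⊓ U β)),
          ((Spec.map (Z.presheaf.map (homOfLE (inf_le_right : U α ⊓ U β ≤ U β)).op) ≫ g β).appLE (V α ⊓ V β) ⊤
              h₂'.ge ≫ (Scheme.ΓSpecIso (.of Γ(Z, U α ⊓ U β))).hom) a -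
            ((Spec.map (Z.presheaf.map (homOfLE (inf_le_left : U α ⊓ U β ≤ U α)).op) ≫ g α).appLE (V α ⊓ V β) ⊤
              h₁'.ge ≫ (Scheme.ΓSpecIso (.of Γ(Z, U α ⊓ U β))).hom) a =
            ∑ ρ, Z.presheaf.map (homOfLE (le_top : U α ⊓ U β ≤ ⊤)).op (specStructureMap q (j ρ)) * d ρ →
          ∀ ρ, pr.appLE (U α ⊓ U β) (Ub α ⊓ Ub β) (inf_eq_preimage_inf U Ub hUb α β).le (d ρ) =
            ∑ t, ψ₀ (coord e (homOfLE le_top) (dSection X₀ (G ⁻¹ᵁ (V α ⊓ V β)) (G.app (V α ⊓ V β) a)) t) *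
              Sections.equiv fZb _ (c ρ t α β))
    (Gl : Z ⟶ X) (wG : Gl ≫ p = q) (hG₀ : i ≫ Gl = f₀) :
    ∀ ρ t, c ρ t ∈ cechB1 fZb Ub := by
  classical
  have hJ2 := mul_self_eq_bot_of_le_maximalIdeal J hmJ hJle
  -- the two families of local lifts: `gg true = g`, `gg false = fromSpec ≫ G_Z`
  let gg : Bool → ∀ α, (Spec (.of Γ(Z, U α)) ⟶ X) := fun b α => Bool.rec ((hU α).fromSpec ≫ Gl) (g α) b
  have hgt : ∀ α, gg true α = g α := fun α => rfl
  have hgf : ∀ α, gg false α = (hU α).fromSpec ≫ Gl := fun α => rfl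
  have wgg : ∀ b α, gg b α ≫ p = (hU α).fromSpec ≫ q := by
    rintro (_ | _) α
    · rw [hgf]; exact (fromSpec_comp_isLift J p q hi f₀ hJ2 (hU α) Gl wG hG₀).1
    · rw [hgt]; exact w α
  have h₀gg : ∀ b α, Spec.map (i.app (U α)) ≫ gg b α =
      (isAffineOpen_preimage_of_isPullback_mk J hi ⟨U α, hU α⟩).fromSpec ≫ f₀ := by
    rintro (_ | _) α
    · rw [hgf]; exact (fromSpec_comp_isLift J p q hi f₀ hJ2 (hU α) Gl wG hG₀).2.1
    · rw [hgt]; exact h₀ α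
  have hggV : ∀ b α, (gg b α) ⁻¹ᵁ V α = ⊤ := by
    rintro (_ | _) α
    · rw [hgf]; exact (fromSpec_comp_isLift J p q hi f₀ hJ2 (hU α) Gl wG hG₀).2.2 (g α) (h₀ α) (hg α)
    · rw [hgt]; exact hg α
  -- landing of restricted lifts
  have land : ∀ (b b' : Bool) (k m : ι) {W : Z.Opens} (hW : IsAffineOpen W) (hk : W ≤ U k) (hm : W ≤ U m),
      (Spec.map (Z.presheaf.map (homOfLE hk).op) ≫ gg b k) ⁻¹ᵁ V m = ⊤ := fun b b' k m W hW hk hm =>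
    restrict_preimage_eq_top_of_right J q hi f₀ (hU k) (hU m) hW hk hm (gg b k) (gg b' m) hJ2 (hggV b' m)
      (h₀gg b k) (h₀gg b' m)
  have land₂ : ∀ (b : Bool) (k α β : ι) (hk : U α ⊓ U β ≤ U k),
      (Spec.map (Z.presheaf.map (homOfLE hk).op) ≫ gg b k) ⁻¹ᵁ (V α ⊓ V β) = ⊤ := fun b k α β hk => by
    rw [Scheme.Hom.preimage_inf, land b b k α (hU₂ α β) hk inf_le_left, land b b k β (hU₂ α β) hk inf_le_right,
      top_inf_eq]
  have land₁ : ∀ (b : Bool) (α : ι), (Spec.map (Z.presheaf.map (homOfLE (le_refl (U α))).op) ≫ gg b α) ⁻¹ᵁ V α = ⊤ :=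
    fun b α => land b b α α (hU α) le_rfl le_rfl
  -- pair facts and matrices, level 1 (`W = U α`, `V' = V α`) and level 2 (`W = U α ∩ U β`, `V' = V α ∩ V β`)
  have P1 := fun (b b' : Bool) (α : ι) => difference_leibniz_and_mem_ker J p q hi f₀ (hU α) (hU α) (hU α) le_rfl le_rfl
    (gg b α) (gg b' α) hJ2 (hV α) (wgg b α) (wgg b' α) (h₀gg b α) (h₀gg b' α) (land₁ b α) (land₁ b' α) _ _ rfl rfl
  have M1 := fun (b b' : Bool) (α : ι) => exists_coords_of_pair J j p hG e q hi hpr f₀ (hU α) (hU α) (hU α) le_rfl le_rfl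
    (hUb α) (hV α) (gg b α) (gg b' α) hj hspan hind hmJ hJle (wgg b α) (wgg b' α) (h₀gg b α) (h₀gg b' α) (land₁ b α)
    (land₁ b' α) _ _ rfl rfl
  have P2 := fun (b b' : Bool) (k m α β : ι) (hk : U α ⊓ U β ≤ U k) (hm : U α ⊓ U β ≤ U m) =>
    difference_leibniz_and_mem_ker J p q hi f₀ (hU k) (hU m) (hU₂ α β) hk hm (gg b k) (gg b' m) hJ2 (hV₂ α β)
      (wgg b k) (wgg b' m) (h₀gg b k) (h₀gg b' m) (land₂ b k α β hk) (land₂ b' m α β hm) _ _ rfl rfl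
  have M2 := fun (b b' : Bool) (k m α β : ι) (hk : U α ⊓ U β ≤ U k) (hm : U α ⊓ U β ≤ U m) =>
    exists_coords_of_pair J j p hG e q hi hpr f₀ (hU k) (hU m) (hU₂ α β) hk hm (inf_eq_preimage_inf U Ub hUb α β)
      (hV₂ α β) (gg b k) (gg b' m) hj hspan hind hmJ hJle (wgg b k) (wgg b' m) (h₀gg b k) (h₀gg b' m)
      (land₂ b k α β hk) (land₂ b' m α β hm) _ _ rfl rfl
  -- the 0-cochain: matrices of the pairs `(G_α, g_α)` at level 1
  choose e₁ he₁ using fun α => M1 false true α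
  intro ρ t
  rw [mem_cechB1_iff]
  refine ⟨fun α => (Sections.equiv fZb _).symm (e₁ α ρ t), ?_⟩
  funext α β
  rw [cechD0_apply]
  -- notation-free abbreviations for this pair
  have hα : U α ⊓ U β ≤ U α := inf_le_left
  have hβ : U α ⊓ U β ≤ U β := inf_le_right
  -- kernel membership in `J.map` form, levels 1 and 2
  have toJ₂ : ∀ {x : Γ(Z, U α ⊓ U β)}, x ∈ RingHom.ker (i.app (U α ⊓ U β)).hom →
      x ∈ J.map ((Z.presheaf.map (homOfLE (le_top : U α ⊓ U β ≤ ⊤)).op).hom.comp (specStructureMap q)) :=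
    fun hx => by rwa [(app_surjective_and_ker_eq_of_isPullback_mk J hi ⟨U α ⊓ U β, hU₂ α β⟩).2] at hx
  have toJ₁ : ∀ (γ : ι) {x : Γ(Z, U γ)}, x ∈ RingHom.ker (i.app (U γ)).hom →
      x ∈ J.map ((Z.presheaf.map (homOfLE (le_top : U γ ≤ ⊤)).op).hom.comp (specStructureMap q)) :=
    fun γ x hx => by rwa [(app_surjective_and_ker_eq_of_isPullback_mk J hi ⟨U γ, hU γ⟩).2] at hx
  -- level-2 matrices
  obtain ⟨S, hS⟩ := M2 true false α β α β hα hβ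
  obtain ⟨P, hP⟩ := M2 true false α α α β hα hα
  obtain ⟨Q, hQ⟩ := M2 false false α β α β hα hβ
  obtain ⟨R, hR⟩ := M2 false true β β α β hβ hβ
  obtain ⟨P', hP'⟩ := M2 false true α α α β hα hα
  obtain ⟨Z0, hZ0⟩ := M2 true true α α α β hα hα
  -- (A1) `c = S + R`, (A2) `S = P + Q`, (A3) `Z0 = P + P'`
  have A1 : (fun ρ t => Sections.equiv fZb _ (c ρ t α β)) = S + R :=
    matrix_add J j p hG e q hpr hspan hJle (hV₂ α β) (hU₂ α β) (inf_eq_preimage_inf U Ub hUb α β) _ _ _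
      (fun x => (P2 true false α β α β hα hβ).2.1 x) (fun a => toJ₂ ((P2 true false α β α β hα hβ).2.2.2 a))
      (fun a => toJ₂ ((P2 false true β β α β hβ hβ).2.2.2 a)) hS hR
      (fun ψ₀ hψ₀ a d hd ρ => hc α β (land₂ true α α β hα) (land₂ true β α β hβ) ψ₀ hψ₀ a d hd ρ)
  have A2 : S = P + Q :=
    matrix_add J j p hG e q hpr hspan hJle (hV₂ α β) (hU₂ α β) (inf_eq_preimage_inf U Ub hUb α β) _ _ _
      (fun x => (P2 true false α α α β hα hα).2.1 x) (fun a => toJ₂ ((P2 true false α α α β hα hα).2.2.2 a))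
      (fun a => toJ₂ ((P2 false false α β α β hα hβ).2.2.2 a)) hP hQ hS
  have A3 : Z0 = P + P' :=
    matrix_add J j p hG e q hpr hspan hJle (hV₂ α β) (hU₂ α β) (inf_eq_preimage_inf U Ub hUb α β) _ _ _
      (fun x => (P2 true false α α α β hα hα).2.1 x) (fun a => toJ₂ ((P2 true false α α α β hα hα).2.2.2 a))
      (fun a => toJ₂ ((P2 false true α α α β hα hα).2.2.2 a)) hP hP' hZ0
  -- `Z0 = 0`
  have hZ0' : Z0 = 0 :=
    matrix_eq_zero_of_eq J j p hG e q hpr hJle (hV₂ α β) (hU₂ α β) (inf_eq_preimage_inf U Ub hUb α β) _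
      (fun x => (P2 true false α α α β hα hα).2.1 x) hZ0
  -- `Q = 0`: the two restricted global lifts are the SAME morphism `fromSpec_{U α ∩ U β} ≫ G_Z`
  have EQ : Spec.map (Z.presheaf.map (homOfLE hβ).op) ≫ gg false β = Spec.map (Z.presheaf.map (homOfLE hα).op) ≫ gg false α := by
    rw [hgf, hgf, ← Category.assoc, ← Category.assoc, IsAffineOpen.map_fromSpec (hU β) (hU₂ α β),
      IsAffineOpen.map_fromSpec (hU α) (hU₂ α β)]
  have hQ' : Q = 0 := by
    have hψ := chart_congr EQ (land₂ false β α β hβ) (land₂ false α α β hα)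
    simp only [hψ] at hQ
    exact matrix_eq_zero_of_eq J j p hG e q hpr hJle (hV₂ α β) (hU₂ α β) (inf_eq_preimage_inf U Ub hUb α β) _
      (fun x => (P2 false false α α α β hα hα).2.1 x) hQ
  -- restriction from level 1 to level 2
  have hres : ∀ (b b' : Bool) (k : ι) (hk : U α ⊓ U β ≤ U k) (hb : Ub α ⊓ Ub β ≤ Ub k) (l : V α ⊓ V β ≤ V k)
      (cm₂ : Fin r → I → Γ(Zb, Ub α ⊓ Ub β)),
      (∀ (ψ₀ : Γ(X₀.left, G ⁻¹ᵁ (V α ⊓ V β)) →+* Γ(Zb, Ub α ⊓ Ub β)),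
        (∀ a, ψ₀ (G.app (V α ⊓ V β) a) = pr.appLE (U α ⊓ U β) (Ub α ⊓ Ub β) (inf_eq_preimage_inf U Ub hUb α β).le
          (((Spec.map (Z.presheaf.map (homOfLE hk).op) ≫ gg b k).appLE (V α ⊓ V β) ⊤ (land₂ b k α β hk).ge ≫
            (Scheme.ΓSpecIso (.of Γ(Z, U α ⊓ U β))).hom) a)) →
        ∀ (a : Γ(X, V α ⊓ V β)) (d : Fin r → Γ(Z, U α ⊓ U β)),
          ((Spec.map (Z.presheaf.map (homOfLE hk).op) ≫ gg b' k).appLE (V α ⊓ V β) ⊤ (land₂ b' k α β hk).ge ≫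
              (Scheme.ΓSpecIso (.of Γ(Z, U α ⊓ U β))).hom) a -
            ((Spec.map (Z.presheaf.map (homOfLE hk).op) ≫ gg b k).appLE (V α ⊓ V β) ⊤ (land₂ b k α β hk).ge ≫
              (Scheme.ΓSpecIso (.of Γ(Z, U α ⊓ U β))).hom) a =
            ∑ ρ, Z.presheaf.map (homOfLE (le_top : U α ⊓ U β ≤ ⊤)).op (specStructureMap q (j ρ)) * d ρ →
          ∀ ρ, pr.appLE (U α ⊓ U β) (Ub α ⊓ Ub β) (inf_eq_preimage_inf U Ub hUb α β).le (d ρ) =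
            ∑ t, ψ₀ (coord e (homOfLE le_top) (dSection X₀ (G ⁻¹ᵁ (V α ⊓ V β)) (G.app (V α ⊓ V β) a)) t) * cm₂ ρ t) →
      ∀ (cm₁ : Fin r → I → Γ(Zb, Ub k)),
      (∀ (ψ₀ : Γ(X₀.left, G ⁻¹ᵁ V k) →+* Γ(Zb, Ub k)),
        (∀ a, ψ₀ (G.app (V k) a) = pr.appLE (U k) (Ub k) (hUb k).le
          (((Spec.map (Z.presheaf.map (homOfLE (le_refl (U k))).op) ≫ gg b k).appLE (V k) ⊤ (land₁ b k).ge ≫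
            (Scheme.ΓSpecIso (.of Γ(Z, U k))).hom) a)) →
        ∀ (a : Γ(X, V k)) (d : Fin r → Γ(Z, U k)),
          ((Spec.map (Z.presheaf.map (homOfLE (le_refl (U k))).op) ≫ gg b' k).appLE (V k) ⊤ (land₁ b' k).ge ≫
              (Scheme.ΓSpecIso (.of Γ(Z, U k))).hom) a -
            ((Spec.map (Z.presheaf.map (homOfLE (le_refl (U k))).op) ≫ gg b k).appLE (V k) ⊤ (land₁ b k).ge ≫
              (Scheme.ΓSpecIso (.of Γ(Z, U k))).hom) a =
            ∑ ρ, Z.presheaf.map (homOfLE (le_top : U k ≤ ⊤)).op (specStructureMap q (j ρ)) * d ρ →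
          ∀ ρ, pr.appLE (U k) (Ub k) (hUb k).le (d ρ) =
            ∑ t, ψ₀ (coord e (homOfLE le_top) (dSection X₀ (G ⁻¹ᵁ V k) (G.app (V k) a)) t) * cm₁ ρ t) →
      cm₂ = fun ρ t => Zb.presheaf.map (homOfLE hb).op (cm₁ ρ t) := by
    intro b b' k hk hb l cm₂ h2 cm₁ h1
    have E₁ := specMap_res_comp_eq (X := X) (le_refl (U k)) hk (gg b k)
    have E₂ := specMap_res_comp_eq (X := X) (le_refl (U k)) hk (gg b' k)
    have hl₁' : (Spec.map (Z.presheaf.map (homOfLE hk).op) ≫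
        (Spec.map (Z.presheaf.map (homOfLE (le_refl (U k))).op) ≫ gg b k)) ⁻¹ᵁ (V α ⊓ V β) = ⊤ := by
      rw [E₁]; exact land₂ b k α β hk
    have hl₂' : (Spec.map (Z.presheaf.map (homOfLE hk).op) ≫
        (Spec.map (Z.presheaf.map (homOfLE (le_refl (U k))).op) ≫ gg b' k)) ⁻¹ᵁ (V α ⊓ V β) = ⊤ := by
      rw [E₂]; exact land₂ b' k α β hk
    refine matrix_restrict J j p hG e q hpr hspan hJle (hV k) (hV₂ α β) l (hU k) (hU₂ α β) hk (hUb k)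
      (inf_eq_preimage_inf U Ub hUb α β) hb _ _ _ _ (fun x => (P1 b b' k).2.1 x) (fun x => (P2 b b' k k α β hk hk).2.1 x)
      (fun a => ?_) (fun a => ?_) (fun a => toJ₁ k ((P1 b b' k).2.2.2 a)) h1 h2
    · rw [congrArg (fun φ => φ.hom (X.presheaf.map (homOfLE l).op a)) (chart_congr E₁.symm (land₂ b k α β hk) hl₁')]
      exact chart_restrict_apply (hV k) l _ (land₁ b k) _ hl₁' a
    · rw [congrArg (fun φ => φ.hom (X.presheaf.map (homOfLE l).op a)) (chart_congr E₂.symm (land₂ b' k α β hk) hl₂')]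
      exact chart_restrict_apply (hV k) l _ (land₁ b' k) _ hl₂' a
  have RP' : P' = fun ρ t => Zb.presheaf.map (homOfLE (inf_le_left : Ub α ⊓ Ub β ≤ Ub α)).op (e₁ α ρ t) :=
    hres false true α hα inf_le_left inf_le_left P' hP' (e₁ α) (he₁ α)
  have RR : R = fun ρ t => Zb.presheaf.map (homOfLE (inf_le_right : Ub α ⊓ Ub β ≤ Ub β)).op (e₁ β ρ t) :=
    hres false true β hβ inf_le_right inf_le_right R hR (e₁ β) (he₁ β)
  -- assemble: `c = S + R = P + Q + R = (Z0 − P') + 0 + R = −e₁ α| + e₁ β|`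
  have key := congrFun (congrFun A1 ρ) t
  simp only [A2, hQ', add_zero, Pi.add_apply] at key
  have hP₁ : P ρ t = -(P' ρ t) := by
    have h3 := congrFun (congrFun A3 ρ) t
    rw [hZ0', Pi.zero_apply, Pi.add_apply] at h3
    exact eq_neg_of_add_eq_zero_left h3.symm
  rw [hP₁, RP', RR] at key
  simp only at key
  change Zb.presheaf.map (homOfLE (inf_le_right : Ub α ⊓ Ub β ≤ Ub β)).op (e₁ β ρ t) -
    Zb.presheaf.map (homOfLE (inf_le_left : Ub α ⊓ Ub β ≤ Ub α)).op (e₁ α ρ t) = Sections.equiv fZb _ (c ρ t α β)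
  rw [key]
  abel

end Lift

/-! ### §2 Functoriality in the source: the characteristic identities pull back along `s : Z' → Z` -/

section Comap

variable {A : Type u} [CommRing A] [IsLocalRing A] (J : Ideal A) {r : ℕ} (j : Fin r → A)
  {X : Scheme.{u}} (p : X ⟶ Spec (.of A)) {X₀ : Over (Spec (.of (A ⧸ J)))} {G : X₀.left ⟶ X}
  (hG : IsPullback G X₀.hom p (Spec.map (CommRingCat.ofHom (Ideal.Quotient.mk J))))
  {I : Type u} [Fintype I] (e : SheafOfModules.free I ≅ (cotangentSheaf X₀).over ⊤)
  {Z Zb Z' Zb' : Scheme.{u}} (q : Z ⟶ Spec (.of A)) {qb : Zb ⟶ Spec (.of (ResidueField A))} {pr : Zb ⟶ Z}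
  (hpr : IsPullback pr qb q (Spec.map (CommRingCat.ofHom (residue A))))
  (q' : Z' ⟶ Spec (.of A)) {qb' : Zb' ⟶ Spec (.of (ResidueField A))} {pr' : Zb' ⟶ Z'}
  (hpr' : IsPullback pr' qb' q' (Spec.map (CommRingCat.ofHom (residue A))))
  (s : Z' ⟶ Z) (sb : Zb' ⟶ Zb)

include hG hpr hpr' in
/-- **The characteristic identities PULL BACK along a morphism of sources** ([SGA1] III 5.1, «fonctoriel en `Y`»;
[MFK94] Prop. 6.15: «`ḡ_i^*(β) = β_i`»).  For `s : Z' → Z` over `S` (`Z'` FLAT over `A` too) with fibre `s̄` (`hsq`: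
`pr'♯ ∘ s♯ = s̄♯ ∘ pr♯` on the opens at hand), affine `W' ⊆ s⁻¹W`, charts `ψₖ' = s♯ ∘ ψₖ` on `Γ(X, V')`: if `cm`
satisfies the characteristic identities of `(ψ₁, ψ₂)` then `s̄♯ ∘ cm` satisfies those of `(ψ₁', ψ₂')` — any decomposition
`ψ₂'(a) − ψ₁'(a) = ∑ j_ρ d'_ρ` on `Z'` agrees modulo `𝔪` with the pushed-forward decomposition (★ C3 uniqueness by
flatness of `Γ(Z', W')`). [cite: SGA1, Exp. III §5 Prop. 5.1] [cite: MumfordFogartyKirwan1994, Ch. 6 §3 Prop. 6.15 (pp. 124–125)] -/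
theorem pchar_comap [Flat q'] (hspan : J ≤ Ideal.span (Set.range j))
    (hind : ∀ a : Fin r → A, ∑ ρ, a ρ * j ρ = 0 → ∀ ρ, a ρ ∈ maximalIdeal A) (hJle : J ≤ maximalIdeal A)
    {V' : X.Opens} (hV' : IsAffineOpen V') {W : Z.Opens} (hW : IsAffineOpen W) {W' : Z'.Opens} (hW' : IsAffineOpen W')
    (hle : W' ≤ s ⁻¹ᵁ W) {Wb : Zb.Opens} (hWb : Wb = pr ⁻¹ᵁ W) {Wb' : Zb'.Opens} (hWb' : Wb' = pr' ⁻¹ᵁ W')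
    (hleb : Wb' ≤ sb ⁻¹ᵁ Wb)
    (hsq : ∀ x : Γ(Z, W), pr'.appLE W' Wb' hWb'.le (s.appLE W W' hle x) = sb.appLE Wb Wb' hleb (pr.appLE W Wb hWb.le x))
    (hss : ∀ x : A, s.appLE W W' hle (Z.presheaf.map (homOfLE (le_top : W ≤ ⊤)).op (specStructureMap q x)) =
      Z'.presheaf.map (homOfLE (le_top : W' ≤ ⊤)).op (specStructureMap q' x))
    (ψ₁ ψ₂ : Γ(X, V') →+* Γ(Z, W)) (ψ₁' ψ₂' : Γ(X, V') →+* Γ(Z', W'))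
    (hs₁ : ∀ x : A, ψ₁ (X.presheaf.map (homOfLE (le_top : V' ≤ ⊤)).op (specStructureMap p x)) =
      Z.presheaf.map (homOfLE (le_top : W ≤ ⊤)).op (specStructureMap q x))
    (hr₁ : ∀ a, ψ₁' a = s.appLE W W' hle (ψ₁ a)) (hr₂ : ∀ a, ψ₂' a = s.appLE W W' hle (ψ₂ a))
    (hδ₁₂ : ∀ a, ψ₂ a - ψ₁ a ∈ J.map ((Z.presheaf.map (homOfLE (le_top : W ≤ ⊤)).op).hom.comp (specStructureMap q)))
    {cm : Fin r → I → Γ(Zb, Wb)}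
    (h : ∀ (ψ₀ : Γ(X₀.left, G ⁻¹ᵁ V') →+* Γ(Zb, Wb)), (∀ a, ψ₀ (G.app V' a) = pr.appLE W Wb hWb.le (ψ₁ a)) →
      ∀ (a : Γ(X, V')) (d : Fin r → Γ(Z, W)),
        ψ₂ a - ψ₁ a = ∑ ρ, Z.presheaf.map (homOfLE (le_top : W ≤ ⊤)).op (specStructureMap q (j ρ)) * d ρ →
        ∀ ρ, pr.appLE W Wb hWb.le (d ρ) =
          ∑ t, ψ₀ (coord e (homOfLE le_top) (dSection X₀ (G ⁻¹ᵁ V') (G.app V' a)) t) * cm ρ t) :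
    ∀ (ψ₀ : Γ(X₀.left, G ⁻¹ᵁ V') →+* Γ(Zb', Wb')), (∀ a, ψ₀ (G.app V' a) = pr'.appLE W' Wb' hWb'.le (ψ₁' a)) →
      ∀ (a : Γ(X, V')) (d : Fin r → Γ(Z', W')),
        ψ₂' a - ψ₁' a = ∑ ρ, Z'.presheaf.map (homOfLE (le_top : W' ≤ ⊤)).op (specStructureMap q' (j ρ)) * d ρ →
        ∀ ρ, pr'.appLE W' Wb' hWb'.le (d ρ) =
          ∑ t, ψ₀ (coord e (homOfLE le_top) (dSection X₀ (G ⁻¹ᵁ V') (G.app V' a)) t) *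
            sb.appLE Wb Wb' hleb (cm ρ t) := by
  classical
  letI algZ : Algebra A Γ(Z, W) :=
    ((Z.presheaf.map (homOfLE (le_top : W ≤ ⊤)).op).hom.comp (specStructureMap q)).toAlgebra
  letI algZ' : Algebra A Γ(Z', W') :=
    ((Z'.presheaf.map (homOfLE (le_top : W' ≤ ⊤)).op).hom.comp (specStructureMap q')).toAlgebra
  haveI : Module.Flat A Γ(Z', W') := moduleFlat_sections_of_flat q' hW'
  obtain ⟨ψ₀, hψ₀⟩ := exists_reducedChart J hG hpr hJle hV' hW hWb ψ₁ hs₁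
  obtain ⟨hsurj, -⟩ := app_surjective_and_ker_eq_of_isPullback_mk J hG ⟨V', hV'⟩
  obtain ⟨-, hθk'⟩ := appLE_surjective_and_ker_eq_of_eq pr' hWb' (app_surjective_and_ker_eq_of_isPullback_residue hpr' ⟨W', hW'⟩).1
  have hkerθ' : RingHom.ker (pr'.appLE W' Wb' hWb'.le).hom = (maximalIdeal A).map (algebraMap A Γ(Z', W')) := by
    rw [hθk']; exact (app_surjective_and_ker_eq_of_isPullback_residue hpr' ⟨W', hW'⟩).2
  intro ψ₀' hψ₀' a d' hd' ρ
  -- `ψ₀' = s̄♯ ∘ ψ₀`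
  have hψeq : ψ₀' = (sb.appLE Wb Wb' hleb).hom.comp ψ₀ :=
    reducedChart_unique (J := J) hsurj hψ₀' fun a => by
      rw [RingHom.comp_apply, hψ₀, ← hsq, ← hr₁]
  -- push a decomposition of `ψ₂ a − ψ₁ a` forward along `s♯`
  obtain ⟨d, hd⟩ := exists_eq_sum_mul_of_mem_map (C := Γ(Z, W)) j hspan (hδ₁₂ a)
  have hd'' : ψ₂' a - ψ₁' a = ∑ ρ, algebraMap A Γ(Z', W') (j ρ) * s.appLE W W' hle (d ρ) := by
    rw [hr₁, hr₂, ← map_sub, hd, map_sum]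
    refine Finset.sum_congr rfl fun ρ _ => ?_
    rw [map_mul]
    congr 1
    exact hss (j ρ)
  -- uniqueness of coordinates modulo `𝔪` on the flat `Γ(Z', W')`
  have hdiff : d' ρ - s.appLE W W' hle (d ρ) ∈ (maximalIdeal A).map (algebraMap A Γ(Z', W')) :=
    sub_mem_map_maximalIdeal_of_sum_mul_eq j hind (hd'.symm.trans hd'') ρ
  have hθeq : pr'.appLE W' Wb' hWb'.le (d' ρ) = pr'.appLE W' Wb' hWb'.le (s.appLE W W' hle (d ρ)) := by
    rw [← sub_eq_zero, ← map_sub]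
    have hk : d' ρ - s.appLE W W' hle (d ρ) ∈ RingHom.ker (pr'.appLE W' Wb' hWb'.le).hom := by
      rw [hkerθ']; exact hdiff
    exact hk
  rw [hθeq, hsq, h ψ₀ hψ₀ a d hd ρ, map_sum, hψeq]
  exact Finset.sum_congr rfl fun t _ => by rw [map_mul, RingHom.comp_apply]

end Comap

section ComapCover

variable {A : Type u} [CommRing A] [IsLocalRing A] (J : Ideal A) {r : ℕ} (j : Fin r → A)
  {X : Scheme.{u}} (p : X ⟶ Spec (.of A)) {X₀ : Over (Spec (.of (A ⧸ J)))} {G : X₀.left ⟶ X}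
  (hG : IsPullback G X₀.hom p (Spec.map (CommRingCat.ofHom (Ideal.Quotient.mk J))))
  {I : Type u} [Fintype I] (e : SheafOfModules.free I ≅ (cotangentSheaf X₀).over ⊤)
  {Z Z₀ Zb Z' Zb' : Scheme.{u}} (q : Z ⟶ Spec (.of A)) {q₀ : Z₀ ⟶ Spec (.of (A ⧸ J))} {i : Z₀ ⟶ Z}
  (hi : IsPullback i q₀ q (Spec.map (CommRingCat.ofHom (Ideal.Quotient.mk J))))
  {qb : Zb ⟶ Spec (.of (ResidueField A))} {pr : Zb ⟶ Z}
  (hpr : IsPullback pr qb q (Spec.map (CommRingCat.ofHom (residue A)))) (fZb : Zb ⟶ Spec (.of A))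
  (q' : Z' ⟶ Spec (.of A)) {qb' : Zb' ⟶ Spec (.of (ResidueField A))} {pr' : Zb' ⟶ Z'}
  (hpr' : IsPullback pr' qb' q' (Spec.map (CommRingCat.ofHom (residue A)))) (fZb' : Zb' ⟶ Spec (.of A))
  (s : Z' ⟶ Z) (hs : s ≫ q = q') (sb : Zb' ⟶ Zb) (hsqm : pr' ≫ s = sb ≫ pr) (hsbf : sb ≫ fZb = fZb')
  (f₀ : Z₀ ⟶ X) {ι : Type*} (U : ι → Z.Opens) (V : ι → X.Opens) (Ub : ι → Zb.Opens)
  (hU : ∀ α, IsAffineOpen (U α)) (hU₂ : ∀ α β, IsAffineOpen (U α ⊓ U β))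
  (hU'₂ : ∀ α β, IsAffineOpen (s ⁻¹ᵁ U α ⊓ s ⁻¹ᵁ U β))
  (hV₂ : ∀ α β, IsAffineOpen (V α ⊓ V β)) (hUb : ∀ α, Ub α = pr ⁻¹ᵁ U α)
  (g : ∀ α, Spec (.of Γ(Z, U α)) ⟶ X) (w : ∀ α, g α ≫ p = (hU α).fromSpec ≫ q) (hg : ∀ α, (g α) ⁻¹ᵁ V α = ⊤)
  (h₀ : ∀ α, Spec.map (i.app (U α)) ≫ g α = (isAffineOpen_preimage_of_isPullback_mk J hi ⟨U α, hU α⟩).fromSpec ≫ f₀)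

include hsqm hUb in
/-- `s̄⁻¹Ū_α = pr'⁻¹(s⁻¹U_α)`. [cite: StacksProject, Tag 01ED (Cohomology, Section 20.9)] -/
theorem preimage_eq_preimage_preimage (α : ι) : sb ⁻¹ᵁ Ub α = pr' ⁻¹ᵁ (s ⁻¹ᵁ U α) := by
  rw [hUb α, ← Scheme.Hom.comp_preimage, ← Scheme.Hom.comp_preimage, hsqm]

/-- Two commuting squares of `appLE`'s: `pr'♯(s♯ x) = s̄♯(pr♯ x)` from `pr' ≫ s = s̄ ≫ pr`. [cite: StacksProject, Tag 01ED (Cohomology, Section 20.9)] -/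
theorem appLE_appLE_comm {W : Z.Opens} {W' : Z'.Opens} {Wb : Zb.Opens} {Wb' : Zb'.Opens} (hsqm : pr' ≫ s = sb ≫ pr)
    (hle : W' ≤ s ⁻¹ᵁ W) (hWb : Wb ≤ pr ⁻¹ᵁ W) (hWb' : Wb' ≤ pr' ⁻¹ᵁ W') (hleb : Wb' ≤ sb ⁻¹ᵁ Wb) (x : Γ(Z, W)) :
    pr'.appLE W' Wb' hWb' (s.appLE W W' hle x) = sb.appLE Wb Wb' hleb (pr.appLE W Wb hWb x) := by
  rw [← CommRingCat.comp_apply, ← CommRingCat.comp_apply, Scheme.Hom.appLE_comp_appLE, Scheme.Hom.appLE_comp_appLE]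
  have : ∀ (m₁ m₂ : Zb' ⟶ Z) (hm : m₁ = m₂) (e₁ : Wb' ≤ m₁ ⁻¹ᵁ W) (e₂ : Wb' ≤ m₂ ⁻¹ᵁ W),
      m₁.appLE W Wb' e₁ = m₂.appLE W Wb' e₂ := by
    intro m₁ m₂ hm e₁ e₂; subst hm; rfl
  exact congrArg (fun φ => φ.hom x) (this _ _ hsqm _ _)

omit [IsLocalRing A] in
include hs in
/-- `s♯` intertwines the structure maps of `Z` and `Z'` (`s` is over `S`). [cite: StacksProject, Tag 01ED (Cohomology, Section 20.9)] -/
theorem appLE_specStructureMap {W : Z.Opens} {W' : Z'.Opens} (hle : W' ≤ s ⁻¹ᵁ W) (x : A) :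
    s.appLE W W' hle (Z.presheaf.map (homOfLE (le_top : W ≤ ⊤)).op (specStructureMap q x)) =
      Z'.presheaf.map (homOfLE (le_top : W' ≤ ⊤)).op (specStructureMap q' x) := by
  rw [← hs, specStructureMap_comp, RingHom.comp_apply]
  change (Z.presheaf.map (homOfLE (le_top : W ≤ ⊤)).op ≫ s.appLE W W' hle) (specStructureMap q x) =
    (s.appTop ≫ Z'.presheaf.map (homOfLE (le_top : W' ≤ ⊤)).op) (specStructureMap q x)
  rw [Scheme.Hom.map_appLE]
  rfl

/-- The restriction of a pulled-back lift is the pull-back of the restricted lift (naturality of `s♯` read through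
`Spec`). [cite: SGA1, Exp. III §5 Prop. 5.1] -/
theorem specMap_res_comp_pullback_eq {U' : Z.Opens} {W : Z.Opens} {W' : Z'.Opens} (hW : W ≤ U') (hW' : W' ≤ s ⁻¹ᵁ U')
    (hle : W' ≤ s ⁻¹ᵁ W) (t : Spec (.of Γ(Z, U')) ⟶ X) :
    Spec.map (Z'.presheaf.map (homOfLE hW').op) ≫ (Spec.map (s.app U') ≫ t) =
      Spec.map (s.appLE W W' hle) ≫ (Spec.map (Z.presheaf.map (homOfLE hW).op) ≫ t) := by
  rw [← Category.assoc, ← Category.assoc, ← Spec.map_comp, ← Spec.map_comp]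
  congr 2
  rw [Scheme.Hom.app_eq_appLE, Scheme.Hom.appLE_map, Scheme.Hom.map_appLE]

include hG hi hpr hpr' hs hsqm hU hU₂ hU'₂ hV₂ hUb w hg h₀ in
/-- **THE CHARACTERISTIC IDENTITIES OF A FAMILY PULL BACK ALONG `s : Z' → Z`** ([SGA1] III 5.1 functoriality; [MFK94]
Prop. 6.15 «`ḡ_i^*β = β_i`»): if the cochains `c ρ t ∈ Č¹(Ū, 𝒪_{Z̄})` carry the characteristic identities of the local
lifts `(g_α)` on the cover `(U_α)` of `Z`, then the pulled-back cochains `s̄^*(c ρ t) ∈ Č¹(s̄⁻¹Ū, 𝒪_{Z̄'})` (★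
`cechComapC1`) carry those of the pulled-back lifts `Spec (s♯) ≫ g_α` on the cover `(s⁻¹U_α)` of the flat `A`-scheme
`Z'` (★ `pchar_comap` on every pair). [cite: SGA1, Exp. III §5 Prop. 5.1]
[cite: MumfordFogartyKirwan1994, Ch. 6 §3 Prop. 6.15 (pp. 124–125)] -/
theorem cechCochain_char_comap [Flat q'] (hspan : J ≤ Ideal.span (Set.range j))
    (hind : ∀ a : Fin r → A, ∑ ρ, a ρ * j ρ = 0 → ∀ ρ, a ρ ∈ maximalIdeal A)
    (hmJ : maximalIdeal A * J = ⊥) (hJle : J ≤ maximalIdeal A)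
    (c : Fin r → I → CechC1 fZb Ub)
    (hc : ∀ (α β : ι)
        (h₁' : (Spec.map (Z.presheaf.map (homOfLE (inf_le_left : U α ⊓ U β ≤ U α)).op) ≫ g α) ⁻¹ᵁ (V α ⊓ V β) = ⊤)
        (h₂' : (Spec.map (Z.presheaf.map (homOfLE (inf_le_right : U α ⊓ U β ≤ U β)).op) ≫ g β) ⁻¹ᵁ (V α ⊓ V β) = ⊤)
        (ψ₀ : Γ(X₀.left, G ⁻¹ᵁ (V α ⊓ V β)) →+* Γ(Zb, Ub α ⊓ Ub β)),
        (∀ a, ψ₀ (G.app (V α ⊓ V β) a) =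
          pr.appLE (U α ⊓ U β) (Ub α ⊓ Ub β) (inf_eq_preimage_inf U Ub hUb α β).le
            (((Spec.map (Z.presheaf.map (homOfLE (inf_le_left : U α ⊓ U β ≤ U α)).op) ≫ g α).appLE (V α ⊓ V β) ⊤
              h₁'.ge ≫ (Scheme.ΓSpecIso (.of Γ(Z, U α ⊓ U β))).hom) a)) →
        ∀ (a : Γ(X, V α ⊓ V β)) (d : Fin r → Γ(Z, U α ⊓ U β)),
          ((Spec.map (Z.presheaf.map (homOfLE (inf_le_right : U α ⊓ U β ≤ U β)).op) ≫ g β).appLE (V α ⊓ V β) ⊤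
              h₂'.ge ≫ (Scheme.ΓSpecIso (.of Γ(Z, U α ⊓ U β))).hom) a -
            ((Spec.map (Z.presheaf.map (homOfLE (inf_le_left : U α ⊓ U β ≤ U α)).op) ≫ g α).appLE (V α ⊓ V β) ⊤
              h₁'.ge ≫ (Scheme.ΓSpecIso (.of Γ(Z, U α ⊓ U β))).hom) a =
            ∑ ρ, Z.presheaf.map (homOfLE (le_top : U α ⊓ U β ≤ ⊤)).op (specStructureMap q (j ρ)) * d ρ →
          ∀ ρ, pr.appLE (U α ⊓ U β) (Ub α ⊓ Ub β) (inf_eq_preimage_inf U Ub hUb α β).le (d ρ) =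
            ∑ t, ψ₀ (coord e (homOfLE le_top) (dSection X₀ (G ⁻¹ᵁ (V α ⊓ V β)) (G.app (V α ⊓ V β) a)) t) *
              Sections.equiv fZb _ (c ρ t α β)) :
    ∀ (α β : ι)
      (h₁' : (Spec.map (Z'.presheaf.map (homOfLE (inf_le_left : s ⁻¹ᵁ U α ⊓ s ⁻¹ᵁ U β ≤ s ⁻¹ᵁ U α)).op) ≫
        (Spec.map (s.app (U α)) ≫ g α)) ⁻¹ᵁ (V α ⊓ V β) = ⊤)
      (h₂' : (Spec.map (Z'.presheaf.map (homOfLE (inf_le_right : s ⁻¹ᵁ U α ⊓ s ⁻¹ᵁ U β ≤ s ⁻¹ᵁ U β)).op) ≫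
        (Spec.map (s.app (U β)) ≫ g β)) ⁻¹ᵁ (V α ⊓ V β) = ⊤)
      (ψ₀ : Γ(X₀.left, G ⁻¹ᵁ (V α ⊓ V β)) →+* Γ(Zb', sb ⁻¹ᵁ Ub α ⊓ sb ⁻¹ᵁ Ub β)),
      (∀ a, ψ₀ (G.app (V α ⊓ V β) a) =
        pr'.appLE (s ⁻¹ᵁ U α ⊓ s ⁻¹ᵁ U β) (sb ⁻¹ᵁ Ub α ⊓ sb ⁻¹ᵁ Ub β)
          (inf_eq_preimage_inf (fun α => s ⁻¹ᵁ U α) (fun α => sb ⁻¹ᵁ Ub α)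
            (preimage_eq_preimage_preimage (pr := pr) s sb hsqm U Ub hUb) α β).le
          (((Spec.map (Z'.presheaf.map (homOfLE (inf_le_left : s ⁻¹ᵁ U α ⊓ s ⁻¹ᵁ U β ≤ s ⁻¹ᵁ U α)).op) ≫
            (Spec.map (s.app (U α)) ≫ g α)).appLE (V α ⊓ V β) ⊤ h₁'.ge ≫
              (Scheme.ΓSpecIso (.of Γ(Z', s ⁻¹ᵁ U α ⊓ s ⁻¹ᵁ U β))).hom) a)) →
      ∀ (a : Γ(X, V α ⊓ V β)) (d : Fin r → Γ(Z', s ⁻¹ᵁ U α ⊓ s ⁻¹ᵁ U β)),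
        ((Spec.map (Z'.presheaf.map (homOfLE (inf_le_right : s ⁻¹ᵁ U α ⊓ s ⁻¹ᵁ U β ≤ s ⁻¹ᵁ U β)).op) ≫
            (Spec.map (s.app (U β)) ≫ g β)).appLE (V α ⊓ V β) ⊤ h₂'.ge ≫
              (Scheme.ΓSpecIso (.of Γ(Z', s ⁻¹ᵁ U α ⊓ s ⁻¹ᵁ U β))).hom) a -
          ((Spec.map (Z'.presheaf.map (homOfLE (inf_le_left : s ⁻¹ᵁ U α ⊓ s ⁻¹ᵁ U β ≤ s ⁻¹ᵁ U α)).op) ≫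
            (Spec.map (s.app (U α)) ≫ g α)).appLE (V α ⊓ V β) ⊤ h₁'.ge ≫
              (Scheme.ΓSpecIso (.of Γ(Z', s ⁻¹ᵁ U α ⊓ s ⁻¹ᵁ U β))).hom) a =
          ∑ ρ, Z'.presheaf.map (homOfLE (le_top : s ⁻¹ᵁ U α ⊓ s ⁻¹ᵁ U β ≤ ⊤)).op (specStructureMap q' (j ρ)) * d ρ →
        ∀ ρ, pr'.appLE (s ⁻¹ᵁ U α ⊓ s ⁻¹ᵁ U β) (sb ⁻¹ᵁ Ub α ⊓ sb ⁻¹ᵁ Ub β)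
            (inf_eq_preimage_inf (fun α => s ⁻¹ᵁ U α) (fun α => sb ⁻¹ᵁ Ub α)
              (preimage_eq_preimage_preimage (pr := pr) s sb hsqm U Ub hUb) α β).le (d ρ) =
          ∑ t, ψ₀ (coord e (homOfLE le_top) (dSection X₀ (G ⁻¹ᵁ (V α ⊓ V β)) (G.app (V α ⊓ V β) a)) t) *
            Sections.equiv fZb' _ (cechComapC1 fZb fZb' sb hsbf Ub (c ρ t) α β) := by
  intro α β h₁' h₂'
  have hJ2 := mul_self_eq_bot_of_le_maximalIdeal J hmJ hJle
  have hα : U α ⊓ U β ≤ U α := inf_le_left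
  have hβ : U α ⊓ U β ≤ U β := inf_le_right
  have hle : s ⁻¹ᵁ U α ⊓ s ⁻¹ᵁ U β ≤ s ⁻¹ᵁ (U α ⊓ U β) := (Scheme.Hom.preimage_inf s).ge
  have hleb : sb ⁻¹ᵁ Ub α ⊓ sb ⁻¹ᵁ Ub β ≤ sb ⁻¹ᵁ (Ub α ⊓ Ub β) := (Scheme.Hom.preimage_inf sb).ge
  -- landing of the restricted lifts on `Z`
  have l₁ := restrict_preimage_inf_eq_top_left J q hi f₀ (hU α) (hU β) (hU₂ α β) hα hβ (g α) (g β) hJ2 (hg α) (hg β)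
    (h₀ α) (h₀ β)
  have l₂ := restrict_preimage_inf_eq_top_right J q hi f₀ (hU α) (hU β) (hU₂ α β) hα hβ (g α) (g β) hJ2 (hg α) (hg β)
    (h₀ α) (h₀ β)
  obtain ⟨-, hs₁, -, hker⟩ := difference_leibniz_and_mem_ker J p q hi f₀ (hU α) (hU β) (hU₂ α β) hα hβ (g α) (g β) hJ2
    (hV₂ α β) (w α) (w β) (h₀ α) (h₀ β) l₁ l₂ _ _ rfl rfl
  have hkerJ := (app_surjective_and_ker_eq_of_isPullback_mk J hi ⟨U α ⊓ U β, hU₂ α β⟩).2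
  -- the pulled-back restricted lifts are pull-backs of the restricted lifts
  have E₁ := specMap_res_comp_pullback_eq (X := X) s hα (inf_le_left : s ⁻¹ᵁ U α ⊓ s ⁻¹ᵁ U β ≤ s ⁻¹ᵁ U α) hle (g α)
  have E₂ := specMap_res_comp_pullback_eq (X := X) s hβ (inf_le_right : s ⁻¹ᵁ U α ⊓ s ⁻¹ᵁ U β ≤ s ⁻¹ᵁ U β) hle (g β)
  have hl₁' : (Spec.map (s.appLE (U α ⊓ U β) (s ⁻¹ᵁ U α ⊓ s ⁻¹ᵁ U β) hle) ≫
      (Spec.map (Z.presheaf.map (homOfLE hα).op) ≫ g α)) ⁻¹ᵁ (V α ⊓ V β) = ⊤ := by rw [← E₁]; exact h₁'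
  have hl₂' : (Spec.map (s.appLE (U α ⊓ U β) (s ⁻¹ᵁ U α ⊓ s ⁻¹ᵁ U β) hle) ≫
      (Spec.map (Z.presheaf.map (homOfLE hβ).op) ≫ g β)) ⁻¹ᵁ (V α ⊓ V β) = ⊤ := by rw [← E₂]; exact h₂'
  refine pchar_comap J j p hG e q hpr q' hpr' s sb hspan hind hJle (hV₂ α β) (hU₂ α β) (hU'₂ α β) hle
    (inf_eq_preimage_inf U Ub hUb α β)
    (inf_eq_preimage_inf (fun α => s ⁻¹ᵁ U α) (fun α => sb ⁻¹ᵁ Ub α)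
      (preimage_eq_preimage_preimage (pr := pr) s sb hsqm U Ub hUb) α β) hleb (fun x => appLE_appLE_comm s sb hsqm hle _ _ hleb x)
    (fun x => appLE_specStructureMap q q' s hs hle x) _ _ _ _ (fun x => hs₁ x) (fun a => ?_) (fun a => ?_)
    (fun a => by have h := hker a; rw [hkerJ] at h; exact h)
    (fun ψ₀ hψ₀ a d hd ρ => hc α β l₁ l₂ ψ₀ hψ₀ a d hd ρ)
  · rw [congrArg (fun φ => φ.hom a) (chart_congr E₁ h₁' hl₁'),
      congrArg (fun φ => φ.hom a) (chart_specMap_comp_hom (hV₂ α β) _ l₁ _ hl₁')]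
    rfl
  · rw [congrArg (fun φ => φ.hom a) (chart_congr E₂ h₂' hl₂'),
      congrArg (fun φ => φ.hom a) (chart_specMap_comp_hom (hV₂ α β) _ l₂ _ hl₂')]
    rfl

end ComapCover

end Literature.AlgebraicGeometry.Deformation

end
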